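import Summits.BirchSwinnertonDyer.Rank1Residual.X12.O11.RamifiedRelativeValuationLineZp
import Summits.BirchSwinnertonDyer.BirchSwinnertonDyer.Theorems.RamifiedSevenEllipticUnitsRelativeValuationOfDatumPinned
import HarnessLib

set_option linter.dupNamespace false
set_option autoImplicit false

/-!
# K7r crux `EllipticUnitValueSevenOfGZK` (stmt-BirchSwinnertonDyer-19945), line `rubin-formula-zp`, stub
# S_relval — `X12.O11.RamifiedCMRelativeValuationAtZp W p D₀` REDUCED IN THE KERNEL TO NAMED INPUTS ON
# THE TYPED [BKNO] DATA: at each instance of its telescope, a Rubin `p`-adic `L`-function datum `R` for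
# the member (over the telescope's own `D`) and `R₀` for the base `W₀`, with the SEVEN residual inputs
# (Ξ-pin ×2, signs ×2, ramification ×2, (F2) ×2, unit base, (R2) relative period law, (R3) reading of `l`)
# ⇒ S_relval (cell `bsd-cm`, seat `bsd-cm-k7r-c3` g9; helper, `--supports` 19945; the `RubinPadicLFunctionData`
# twin of `…RelativeValuationOfFrameData.lean` p492435, over `…RelativeValuationOfDatumPinned.lean`)

HONEST FRAMING. Nothing is asserted about the crux; no definition, no named fact, `sorry`-free; [BKNO]
enters only as fields of bound data; BSD is not proved by any of this. The registered stub
`stub_relativeValuationSevenZp : ∀ W …, X12.ClassCSeven W → X12.O11.RamifiedCMRelativeValuationAtZp W 7 (−11)`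
(line owner k7r-c4; planner D131: re-base on the landed typing p491797/p492879) closes by
`ramifiedCMRelativeValuationAtZp_of_datumInputs` below the day its hypothesis — S_relval's telescope
VERBATIM, ending in `∃ c R Ω₀ 𝓔₀ D₀' R₀, [the seven inputs]` — is supplied; the v4 split of the line is
that hypothesis cut into its named sources (the line owner's pen): (Ξ) `R.ξ = φ·(φ∘c)⁻¹` (planner LEMMA Ξ
+ littype micro-ask), (sgn) `ε(φ^{2k+1}) = +1` in weight `2k+2` (Lemma 4.4 (1) / Hecke), (ram)
`φ^{2k+1}` ramified on `badPrimes`, (F2) `‖r̂₁(γ) − 1‖² = p⁻¹`, (v) unit base `‖[T⁰]ℒ₀‖ = 1` (Route U),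
(R2) `‖δ_k ι⁻¹(Ω^{2k+1})‖ = ‖δ'_k ι⁻¹(Ω₀^{2k+1})‖`, (R3) `D.HasLocalBottomIndexExpZp l ⇒ ‖[T⁰]ℒ‖² = p^(−l)`
(`thm72_one` + unit bottom period + `ord log_ω(generator) = 0`). The carrier identity of S_relval,
`(heckePowerCentralValue φ (p^m) / heckePowerCentralValue φ₀ (p^m))² = r`, IS the datum theorem's
`(heckeCentralValue (φ^(2p^m+1)) (p^m) / …)² = r` by `rfl`.
References: [BKNO] arXiv:2608.06879 Def. 4.7, Thm. 4.12, Thm. 7.2 [BurungaleKobayashiNakamuraOta2026];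
memo RELATIVE-RUBIN-ram-g9.md §1 THEOREM (2); cell STATUS D123/D127/D128/D131, LEMMA Ξ.
-/

noncomputable section

open scoped Classical NNReal

namespace Summit.BirchSwinnertonDyer.BirchSwinnertonDyer.Theorems.RamifiedSevenEllipticUnits

open WeierstrassCurve NumberField IsDedekindDomain IsDedekindDomain.HeightOneSpectrum Field PowerSeries
  Literature.NumberTheory.EllipticCurves
  Literature.NumberTheory.EllipticCurves.Rank1Residual
  Literature.NumberTheory.EllipticCurves.BurungaleKobayashiNakamuraOta2026
  Literature.NumberTheory.EllipticCurves.Castella2018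
  Literature.NumberTheory.GaloisRepresentations
  Literature.NumberTheory.DiophantineGeometry
  Summit.BirchSwinnertonDyer.Rank1Residual
  Summit.BirchSwinnertonDyer.Rank1Residual.Additive
  Summit.BirchSwinnertonDyer.Rank1Residual.X12
  Summit.BirchSwinnertonDyer.Rank1Residual.X12.O11

namespace RelativeValuationOfDatum

variable {W : WeierstrassCurve ℚ} [W.IsElliptic] [W.IsGloballyMinimal] {p : ℕ} [Fact p.Prime] {D₀ : ℤ}

omit [W.IsGloballyMinimal] in
/-- **S_relval FROM NAMED INPUTS ON THE TYPED DATA (kernel reduction of the registered stub's target).**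
If at every instance of S_relval's telescope — O11 frame, analytic rank one, anticyclotomic `κ` with
generator `γ`, Mordell–Weil data, `#Ш_an`'s, pinned datum `(ι, φ, Ω, 𝓔, D, c)` with the main-conjecture
identity, local bottom exponent `l`, base model `W₀` of `49a1^{(D₀)}` with pinned `φ₀`, exponent `m`,
rational `r ≠ 0` with the two continuations, `(heckePowerCentralValue φ (p^m) / heckePowerCentralValue φ₀
(p^m))² = r` and `padicValRat p r < 1 + 2m` — THERE ARE a complex conjugation `c` of `K`, a Rubin `p`-adic
`L`-function datum `R` over the telescope's `D` ([BKNO] Def. 4.7 / Thm. 4.12 / Thm. 7.2 as its fields), a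
base datum `(Ω₀, 𝓔₀, D₀', R₀)` for `(W₀, φ₀)`, SATISFYING the seven inputs (Ξ) `R.ξ = φ·(φ∘c)⁻¹`,
`R₀.ξ = φ₀·(φ₀∘c)⁻¹`; (sgn) `IsCentralRootNumberWt (φ^(2p^m+1)) (p^m) 1` and for `φ₀`; (ram) `φ^(2p^m+1)`,
`φ₀^(2p^m+1)` ramified at `𝔭` and wherever `φ`, `φ₀` are; `Ω₀ ≠ 0`; (F2) `‖r̂₁(γ) − 1‖² = p⁻¹` for `R` and
`R₀`; (v) `‖[T⁰]R₀.L‖ = 1`; (R2) `‖R.δ_k · ι⁻¹(Ω^{2k+1})‖ = ‖R₀.δ_k · ι⁻¹(Ω₀^{2k+1})‖`; (R3)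
`‖[T⁰]R.L‖² = p^(−l)` — THEN `RamifiedCMRelativeValuationAtZp W p D₀`. Proof: `natCast_eq_padicValRat_of_data_of_xi`
(the frame supplies `p ≥ 5`, the telescope `Ω ≠ 0`, `r ≠ 0`, the threshold; the carrier identity is `rfl`).
[cite: BurungaleKobayashiNakamuraOta2026, Thm. 4.12, Def. 4.7 and Thm. 7.2 (arXiv:2608.06879 pp. 27, 32, 41) (claim; preprint; fields of the data)] -/
theorem ramifiedCMRelativeValuationAtZp_of_datumInputs
    (h : ∀ (K : Type) [Field K] [NumberField K] (𝔭 : HeightOneSpectrum (𝓞 K))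
      (W' : WeierstrassCurve ℚ) [W'.IsElliptic] [W'.IsGloballyMinimal] (C : VariableChange ℚ),
      IsFrame W p K 𝔭 W' C → W.analyticRank = 1 →
      ∀ (κ : ZpExtension K p), κ.IsAnticyclotomic →
        ∀ (γ : absoluteGaloisGroup K) [Fact (κ.IsTopGenerator γ)]
          (P : W.toAffine.Point) (n : ℕ) (P' : W'.toAffine.Point) (n' : ℕ),
          ¬ IsOfFinAddOrder P →
          (∀ R : W.toAffine.Point, ∃ (k : ℤ) (T : W.toAffine.Point), IsOfFinAddOrder T ∧ R = k • P + T) →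
          (∀ Q : (W.baseChange ℚ_[p]).toAffine.Point, p • Q = 0 → Q = 0) →
          (∃ Q : (W.baseChange ℚ_[p]).toAffine.Point, p ^ n • Q = W.toPadicPoint p P) →
          (∀ Q : (W.baseChange ℚ_[p]).toAffine.Point, p ^ (n + 1) • Q ≠ W.toPadicPoint p P) →
          ¬ IsOfFinAddOrder P' →
          (∀ R : W'.toAffine.Point, ∃ (k : ℤ) (T : W'.toAffine.Point),
            IsOfFinAddOrder T ∧ R = k • P' + T) →
          (∀ Q : (W'.baseChange ℚ_[p]).toAffine.Point, p • Q = 0 → Q = 0) →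
          (∃ Q : (W'.baseChange ℚ_[p]).toAffine.Point, p ^ n' • Q = W'.toPadicPoint p P') →
          (∀ Q : (W'.baseChange ℚ_[p]).toAffine.Point, p ^ (n' + 1) • Q ≠ W'.toPadicPoint p P') →
          ∀ (q q' : ℚ), shaAn W = (q : ℂ) → shaAn W' = (q' : ℂ) →
          ∀ (ι : PadicAlgCl p ≃+* ℂ) (φ : HeckeCharacter K) (Ω : ℂ) (𝓔 : AcDualExpSystem W p K 𝔭 κ ι)
            (D : EllipticUnitClassData W p K 𝔭 κ γ ι φ Ω 𝓔) (c : ℕ),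
            Ω ≠ 0 → (∀ s : ℂ, 3 / 2 < s.re → heckeLFunction φ s = W.LSeries s) →
            D.HasBottomIndexExpZp c →
            (∀ (n₀ : ℕ), AcSelmer.XAc.HasCharValuationAt (W.baseChange K) p κ 𝔭 ∅ γ n₀ →
              Finite {x : AcSelmer.XAc (W.baseChange K) p κ 𝔭 ∅ γ //
                (PowerSeries.X : IwasawaAlgebra p) • x = 0} →
              (n₀ : ℤ) + padicValNat p (Nat.card {x : AcSelmer.XAc (W.baseChange K) p κ 𝔭 ∅ γ //
                  (PowerSeries.X : IwasawaAlgebra p) • x = 0}) = c) →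
            ∀ (l : ℕ), D.HasLocalBottomIndexExpZp l →
              ∀ (W₀ : WeierstrassCurve ℚ) [W₀.IsElliptic] [W₀.IsGloballyMinimal],
                (∃ C₀ : VariableChange ℚ, C₀ • W₀ = cm7.quadraticTwist (D₀ : ℚ)) →
                ∀ (φ₀ : HeckeCharacter K),
                  (∀ s : ℂ, 3 / 2 < s.re → heckeLFunction φ₀ s = W₀.LSeries s) →
                  ∀ (m : ℕ) (r : ℚ),
                    LFunction.HasEntireContinuationFrom (((p ^ m : ℕ) : ℝ) + 3 / 2)
                        (heckeLFunction (φ ^ (2 * p ^ m + 1))) →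
                      LFunction.HasEntireContinuationFrom (((p ^ m : ℕ) : ℝ) + 3 / 2)
                        (heckeLFunction (φ₀ ^ (2 * p ^ m + 1))) →
                    (heckePowerCentralValue φ (p ^ m) / heckePowerCentralValue φ₀ (p ^ m)) ^ 2 = (r : ℂ) →
                    r ≠ 0 → padicValRat p r < 1 + 2 * (m : ℤ) →
                    ∃ (cc : K ≃ₐ[ℚ] K) (R : RubinPadicLFunctionData W p K cc 𝔭 κ γ ι φ Ω 𝓔 D)
                      (Ω₀ : ℂ) (𝓔₀ : AcDualExpSystem W₀ p K 𝔭 κ ι)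
                      (D₀' : EllipticUnitClassData W₀ p K 𝔭 κ γ ι φ₀ Ω₀ 𝓔₀)
                      (R₀ : RubinPadicLFunctionData W₀ p K cc 𝔭 κ γ ι φ₀ Ω₀ 𝓔₀ D₀'),
                      R.ξ = φ * (HeckeCharacter.galConj cc φ)⁻¹ ∧
                      R₀.ξ = φ₀ * (HeckeCharacter.galConj cc φ₀)⁻¹ ∧
                      IsCentralRootNumberWt (φ ^ (2 * p ^ m + 1)) (p ^ m) 1 ∧
                      IsCentralRootNumberWt (φ₀ ^ (2 * p ^ m + 1)) (p ^ m) 1 ∧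
                      (∀ w, (w = 𝔭 ∨ ¬ φ.IsUnramifiedAt w) → ¬ (φ ^ (2 * p ^ m + 1)).IsUnramifiedAt w) ∧
                      (∀ w, (w = 𝔭 ∨ ¬ φ₀.IsUnramifiedAt w) →
                        ¬ (φ₀ ^ (2 * p ^ m + 1)).IsUnramifiedAt w) ∧
                      Ω₀ ≠ 0 ∧
                      ‖avatarValueAt R.r γ - 1‖ ^ 2 = ((p : ℝ))⁻¹ ∧
                      ‖avatarValueAt R₀.r γ - 1‖ ^ 2 = ((p : ℝ))⁻¹ ∧
                      ‖((PowerSeries.constantCoeff R₀.L : PadicComplexInt p) : ℂ_[p])‖ = 1 ∧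
                      ‖R.δ (p ^ m) 1 * ((ι.symm (Ω ^ (2 * p ^ m + 1)) : PadicAlgCl p) : ℂ_[p])‖ =
                        ‖R₀.δ (p ^ m) 1 * ((ι.symm (Ω₀ ^ (2 * p ^ m + 1)) : PadicAlgCl p) : ℂ_[p])‖ ∧
                      ‖((PowerSeries.constantCoeff R.L : PadicComplexInt p) : ℂ_[p])‖ ^ 2 =
                        (p : ℝ) ^ (-(l : ℤ))) :
    RamifiedCMRelativeValuationAtZp W p D₀ := by
  intro K _ _ 𝔭 W' _ _ C hF hr κ hκ γ _ P n P' n' hP hgen htors hdiv hndiv hP' hgen' htors' hdiv' hndiv'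
    q q' hq hq' ι φ Ω 𝓔 D c hΩ hφ hc himc l hl W₀ _ _ hW₀ φ₀ hφ₀ m r hcont hcont₀ hρ hr0 hlt
  obtain ⟨cc, R, Ω₀, 𝓔₀, D₀', R₀, hξ, hξ₀, hsgn, hsgn₀, hram, hram₀, hΩ₀, hu, hu₀, hbase, hper, hbottom⟩ :=
    h K 𝔭 W' C hF hr κ hκ γ P n P' n' hP hgen htors hdiv hndiv hP' hgen' htors' hdiv' hndiv' q q' hq hq'
      ι φ Ω 𝓔 D c hΩ hφ hc himc l hl W₀ hW₀ φ₀ hφ₀ m r hcont hcont₀ hρ hr0 hlt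
  exact natCast_eq_padicValRat_of_data_of_xi R R₀ hF.2.2.1 m hξ hξ₀ hsgn hsgn₀ hram hram₀ hΩ hΩ₀ hu hu₀
    hbase hper hr0 hρ hlt hbottom

end RelativeValuationOfDatum

end Summit.BirchSwinnertonDyer.BirchSwinnertonDyer.Theorems.RamifiedSevenEllipticUnits

end
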